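import Literature.Probability.LatticeModels.LatticeSineGordon
import Summits.QuantumFields.YangMills.Theorems.SmallCircleAnchorAnchorGapStubDebyeScreening

/-!
# Crux `AnchorGap` (stmt-QuantumFields-11141), line `registered` — Gaussian (Debye–Hückel) layer under stub DS′

Stub DS′ (`stub_debyeScreening`, corrected quantifier order) of the skeleton
`Cruxes/AnchorGap/Lines/birth.lean` is Debye screening of the lattice sine-Gordon gas on the discrete
three-torus, typed over `Literature.Probability.LatticeModels.LatticeSineGordon`.  Every proof
strategy for it (Brydges 1978 §3 / Brydges–Federbush: Mayer or polymer expansion organised around the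
Debye–Hückel Gaussian) consumes, at its zeroth order, covariance bounds for the MASSIVE lattice
Laplacian `(-Δ_N + m²)⁻¹` on the torus that are UNIFORM IN THE PERIOD `N`.  This file proves them in
elementary form (no Fourier analysis, no operator norms), in the vocabulary of `gaussianAction`:

* `gaussianAction_eq_quadraticForm` — summation by parts on the torus:
  `S_Gauss(φ) = (2g²)⁻¹ Σ_p φ_p ((ε + 2d) φ_p - Σ_i (φ_{p+eᵢ} + φ_{p-eᵢ}))`, i.e. the Gaussian part of
  the sine-Gordon weight is `exp(-½⟨φ, g⁻²(-Δ_N + ε) φ⟩)` with `-Δ_N` the torus Laplacian acting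
  componentwise (valid for every `N ≥ 1`, including the degenerate periods `N = 1, 2`);
* `massiveOp_ker_eq_zero`, `massiveGreen_exists`, `massiveGreen_unique` — the operator
  `M = m² + 2d - Σ_i (τ_{eᵢ} + τ_{-eᵢ})` (`m > 0`) has trivial kernel (maximum principle), hence the
  Green's function `G = M⁻¹` (columnwise equation `M G(·, y) = δ_y`) exists and is unique;
* `massiveGreen_column_bounds` — minimum principle and charge sum rule: `0 ≤ G(x, y)`,
  `Σ_x G(x, y) = 1/m²`, hence `G(x, y) ≤ 1/m²`;
* `massiveGreen_decay` — the random-walk bound, uniform in `N`: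
  `G(x, y) ≤ m⁻² (2d/(m² + 2d))^n` whenever the coordinate difference `x_{i₀} - y_{i₀} ∈ ℤ/N` is not
  represented by any integer of modulus `< n` (each application of the columnwise equation moves one
  lattice step and costs the factor `2d/(m² + 2d) < 1`);
* `torus_coord_far` — the arithmetic glue to the geometry of DS′: for sites `x`, `y` of the cube
  `{v | ∀ i, (v i).val ≤ R₀}` and the translate `y + n e₀` with `2n < N`, the coordinate difference
  `x₀ - (y₀ + n)` is not represented by any integer of modulus `< n - R₀`.

Together: the Debye–Hückel covariance between the two observation cubes of DS′ is
`≤ m_D⁻² (6/(m_D² + 6))^{n - R₀}` uniformly in `N` — the Gaussian skeleton of the claimed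
`C e^{-c n}`.
-/

set_option autoImplicit false

noncomputable section

namespace Summit.QuantumFields.YangMills.Theorems.AnchorGap

open MeasureTheory
open Literature.Probability.LatticeModels

/-- **Minimum principle and charge sum rule for the massive torus Green's function.** If
`(m² + 2d) G(x,y) - Σ_i (G(x+eᵢ,y) + G(x-eᵢ,y)) = δ_{xy}` for all `x, y` (`m > 0`), then `G ≥ 0`
(at a columnwise minimum `x₀`, `m² G(x₀,y) ≥ δ ≥ 0`), every column sums to `1/m²` (sum the equation
over `x`; the shifted sums reindex), hence `G(x,y) ≤ 1/m²`.  Uniform in the period `N`. [folklore] -/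
theorem massiveGreen_column_bounds :
    ∀ (d N : ℕ) [NeZero N] (m : ℝ), 0 < m → ∀ G : TorusSite d N → TorusSite d N → ℝ, (∀ x y : TorusSite d N, (m ^ 2 + 2 * d) * G x y - ∑ i : Fin d, (G (x + Pi.single i 1) y + G (x - Pi.single i 1) y) = if x = y then 1 else 0) → (∀ x y : TorusSite d N, 0 ≤ G x y) ∧ (∀ y : TorusSite d N, ∑ x : TorusSite d N, G x y = (m ^ 2)⁻¹) ∧ (∀ x y : TorusSite d N, G x y ≤ (m ^ 2)⁻¹) := by
  intro d N _ m hm G hG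
  have hm2 : 0 < m ^ 2 := by positivity
  -- minimum principle, column by column
  have hnonneg : ∀ x y : TorusSite d N, 0 ≤ G x y := by
    intro x y
    obtain ⟨x₀, -, hmin⟩ := Finset.exists_min_image Finset.univ (fun x => G x y) Finset.univ_nonempty
    have h0 : 0 ≤ G x₀ y := by
      refine le_of_not_gt fun hneg => ?_
      have heq := hG x₀ y
      have hδ : (0 : ℝ) ≤ if x₀ = y then 1 else 0 := by split_ifs <;> norm_num
      have hsum : ∑ _i : Fin d, (G x₀ y + G x₀ y) ≤
          ∑ i : Fin d, (G (x₀ + Pi.single i 1) y + G (x₀ - Pi.single i 1) y) :=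
        Finset.sum_le_sum fun i _ => add_le_add (hmin _ (Finset.mem_univ _)) (hmin _ (Finset.mem_univ _))
      have hconst : ∑ _i : Fin d, (G x₀ y + G x₀ y) = 2 * d * G x₀ y := by
        rw [Finset.sum_const, Finset.card_univ, Fintype.card_fin, nsmul_eq_mul]; ring
      have : m ^ 2 * G x₀ y < 0 := mul_neg_of_pos_of_neg hm2 hneg
      exact absurd this (by linarith)
    exact h0.trans (hmin x (Finset.mem_univ x))
  -- column sums
  have hcol : ∀ y : TorusSite d N, ∑ x : TorusSite d N, G x y = (m ^ 2)⁻¹ := by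
    intro y
    have hsum : ∑ x : TorusSite d N, ((m ^ 2 + 2 * d) * G x y -
        ∑ i : Fin d, (G (x + Pi.single i 1) y + G (x - Pi.single i 1) y)) =
        ∑ x : TorusSite d N, (if x = y then (1 : ℝ) else 0) := Finset.sum_congr rfl fun x _ => hG x y
    rw [Finset.sum_ite_eq' Finset.univ y (fun _ => (1 : ℝ)), if_pos (Finset.mem_univ y),
      Finset.sum_sub_distrib, ← Finset.mul_sum, Finset.sum_comm] at hsum
    have hshift : ∀ i : Fin d, ∑ x : TorusSite d N, (G (x + Pi.single i 1) y + G (x - Pi.single i 1) y) =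
        2 * ∑ x : TorusSite d N, G x y := by
      intro i
      have h1 : ∑ x : TorusSite d N, G (x + Pi.single i 1) y = ∑ x : TorusSite d N, G x y :=
        Fintype.sum_equiv (Equiv.addRight (Pi.single i (1 : ZMod N))) _ _ fun x => rfl
      have h2 : ∑ x : TorusSite d N, G (x - Pi.single i 1) y = ∑ x : TorusSite d N, G x y :=
        Fintype.sum_equiv (Equiv.subRight (Pi.single i (1 : ZMod N))) _ _ fun x => rfl
      rw [Finset.sum_add_distrib, h1, h2]
      ring
    simp only [hshift, Finset.sum_const, Finset.card_univ, Fintype.card_fin, nsmul_eq_mul] at hsum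
    field_simp
    linarith
  refine ⟨hnonneg, hcol, fun x y => ?_⟩
  rw [← hcol y]
  exact Finset.single_le_sum (fun x' _ => hnonneg x' y) (Finset.mem_univ x)

/-- **Random-walk decay of the massive torus Green's function, uniform in the period.** Under the
columnwise equation `(m² + 2d) G(·,y) - Σ_i (G(· + eᵢ,y) + G(· - eᵢ,y)) = δ_y` (`m > 0`): if the
coordinate difference `x_{i₀} - y_{i₀} ∈ ℤ/N` is not the class of any integer of modulus `< n`, then
`G(x,y) ≤ m⁻² (2d/(m² + 2d))ⁿ` — induction on `n`: for `n + 1` one has `x ≠ y`, so `G(x,y)` is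
`(m² + 2d)⁻¹` times the sum over the `2d` neighbours, each of which is still `n`-far. [folklore] -/
theorem massiveGreen_decay :
    ∀ (d N : ℕ) [NeZero N] (m : ℝ), 0 < m → ∀ G : TorusSite d N → TorusSite d N → ℝ, (∀ x y : TorusSite d N, (m ^ 2 + 2 * d) * G x y - ∑ i : Fin d, (G (x + Pi.single i 1) y + G (x - Pi.single i 1) y) = if x = y then 1 else 0) → ∀ (i₀ : Fin d) (n : ℕ) (x y : TorusSite d N), (∀ z : ℤ, |z| < n → x i₀ - y i₀ ≠ (z : ZMod N)) → G x y ≤ (m ^ 2)⁻¹ * (2 * d / (m ^ 2 + 2 * d)) ^ n := by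
  intro d N _ m hm G hG i₀ n
  obtain ⟨hnonneg, -, hle⟩ := massiveGreen_column_bounds d N m hm G hG
  have hm2 : 0 < m ^ 2 := by positivity
  have hD : 0 < m ^ 2 + 2 * d := by positivity
  induction n with
  | zero => intro x y _; simpa using hle x y
  | succ n ih =>
    intro x y hfar
    have hxy : x ≠ y := by
      intro h
      refine hfar 0 (by simp) ?_
      rw [h, sub_self, Int.cast_zero]
    have heq := hG x y
    rw [if_neg hxy] at heq
    -- every neighbour of `x` is still `n`-far from `y` in direction `i₀`
    have hnb : ∀ (i : Fin d) (s : ℤ), (s = 1 ∨ s = -1) →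
        ∀ z : ℤ, |z| < n → (x + Pi.single i (s : ZMod N) : TorusSite d N) i₀ - y i₀ ≠ (z : ZMod N) := by
      intro i s hs z hz h
      rw [Pi.add_apply] at h
      by_cases hi : i₀ = i
      · subst hi
        rw [Pi.single_eq_same] at h
        refine hfar (z - s) ?_ ?_
        · rcases hs with rfl | rfl <;>
          · rw [abs_lt] at hz ⊢; push_cast; constructor <;> linarith
        · rw [Int.cast_sub, ← h]; ring
      · rw [Pi.single_eq_of_ne hi, add_zero] at h
        exact hfar z (lt_of_lt_of_le hz (by exact_mod_cast n.le_succ)) h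
    have hplus : ∀ i : Fin d, G (x + Pi.single i 1) y ≤ (m ^ 2)⁻¹ * (2 * d / (m ^ 2 + 2 * d)) ^ n := by
      intro i
      have := ih (x + Pi.single i ((1 : ℤ) : ZMod N)) y (hnb i 1 (Or.inl rfl))
      simpa only [Int.cast_one] using this
    have hminus : ∀ i : Fin d, G (x - Pi.single i 1) y ≤ (m ^ 2)⁻¹ * (2 * d / (m ^ 2 + 2 * d)) ^ n := by
      intro i
      have := ih (x + Pi.single i ((-1 : ℤ) : ZMod N)) y (hnb i (-1) (Or.inr rfl))
      simpa only [Int.cast_neg, Int.cast_one, Pi.single_neg, ← sub_eq_add_neg] using this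
    have hsum : ∑ i : Fin d, (G (x + Pi.single i 1) y + G (x - Pi.single i 1) y) ≤
        ∑ _i : Fin d, 2 * ((m ^ 2)⁻¹ * (2 * d / (m ^ 2 + 2 * d)) ^ n) :=
      Finset.sum_le_sum fun i _ => by linarith [hplus i, hminus i]
    rw [Finset.sum_const, Finset.card_univ, Fintype.card_fin, nsmul_eq_mul] at hsum
    have key : G x y ≤ 2 * d / (m ^ 2 + 2 * d) * ((m ^ 2)⁻¹ * (2 * d / (m ^ 2 + 2 * d)) ^ n) := by
      rw [div_mul_eq_mul_div, le_div_iff₀ hD]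
      linarith
    calc G x y ≤ _ := key
      _ = (m ^ 2)⁻¹ * (2 * d / (m ^ 2 + 2 * d)) ^ (n + 1) := by
          rw [pow_succ]; ring

/-- **Maximum principle: the massive torus operator has trivial kernel.** If
`(m² + 2d) u(x) = Σ_i (u(x+eᵢ) + u(x-eᵢ))` for all `x` (`m > 0`), then `u = 0`: at a maximum `x₀` of
`|u|`, `(m² + 2d)|u(x₀)| ≤ 2d |u(x₀)|`. [folklore] -/
theorem massiveOp_ker_eq_zero :
    ∀ (d N : ℕ) [NeZero N] (m : ℝ), 0 < m → ∀ u : TorusSite d N → ℝ, (∀ x : TorusSite d N, (m ^ 2 + 2 * d) * u x - ∑ i : Fin d, (u (x + Pi.single i 1) + u (x - Pi.single i 1)) = 0) → u = 0 := by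
  intro d N _ m hm u hu
  have hm2 : 0 < m ^ 2 := by positivity
  have hD : 0 < m ^ 2 + 2 * d := by positivity
  obtain ⟨x₀, -, hmax⟩ := Finset.exists_max_image Finset.univ (fun x => |u x|) Finset.univ_nonempty
  have heq : (m ^ 2 + 2 * d) * u x₀ = ∑ i : Fin d, (u (x₀ + Pi.single i 1) + u (x₀ - Pi.single i 1)) := by
    linarith [hu x₀]
  have hbound : |∑ i : Fin d, (u (x₀ + Pi.single i 1) + u (x₀ - Pi.single i 1))| ≤ 2 * d * |u x₀| := by
    calc _ ≤ ∑ i : Fin d, |u (x₀ + Pi.single i 1) + u (x₀ - Pi.single i 1)| := Finset.abs_sum_le_sum_abs _ _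
      _ ≤ ∑ _i : Fin d, (|u x₀| + |u x₀|) := Finset.sum_le_sum fun i _ =>
          (abs_add_le _ _).trans (add_le_add (hmax _ (Finset.mem_univ _)) (hmax _ (Finset.mem_univ _)))
      _ = 2 * d * |u x₀| := by
          rw [Finset.sum_const, Finset.card_univ, Fintype.card_fin, nsmul_eq_mul]; ring
  have h1 : (m ^ 2 + 2 * d) * |u x₀| ≤ 2 * d * |u x₀| := by
    rw [← abs_of_pos hD, ← abs_mul, heq]
    exact hbound
  have h2 : |u x₀| ≤ 0 := by
    refine le_of_not_gt fun hpos => ?_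
    have : m ^ 2 * |u x₀| ≤ 0 := by linarith
    exact absurd this (not_le.2 (mul_pos hm2 hpos))
  funext x
  exact abs_nonpos_iff.1 ((hmax x (Finset.mem_univ x)).trans h2)

/-- **The massive torus Green's function is unique**: two solutions of the columnwise equation
coincide (their difference, column by column, lies in the kernel of the massive operator,
`massiveOp_ker_eq_zero`). [folklore] -/
theorem massiveGreen_unique :
    ∀ (d N : ℕ) [NeZero N] (m : ℝ), 0 < m → ∀ G G' : TorusSite d N → TorusSite d N → ℝ, (∀ x y : TorusSite d N, (m ^ 2 + 2 * d) * G x y - ∑ i : Fin d, (G (x + Pi.single i 1) y + G (x - Pi.single i 1) y) = if x = y then 1 else 0) → (∀ x y : TorusSite d N, (m ^ 2 + 2 * d) * G' x y - ∑ i : Fin d, (G' (x + Pi.single i 1) y + G' (x - Pi.single i 1) y) = if x = y then 1 else 0) → G = G' := by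
  intro d N _ m hm G G' hG hG'
  funext x y
  have h := massiveOp_ker_eq_zero d N m hm (fun x => G x y - G' x y) fun x => by
    have h1 := hG x y
    have h2 := hG' x y
    rw [Finset.sum_add_distrib] at h1 h2
    rw [show ∑ i : Fin d, (G (x + Pi.single i 1) y - G' (x + Pi.single i 1) y + (G (x - Pi.single i 1) y - G' (x - Pi.single i 1) y)) =
        (∑ i : Fin d, G (x + Pi.single i 1) y + ∑ i : Fin d, G (x - Pi.single i 1) y) -
          (∑ i : Fin d, G' (x + Pi.single i 1) y + ∑ i : Fin d, G' (x - Pi.single i 1) y) by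
      rw [← Finset.sum_add_distrib, ← Finset.sum_add_distrib, ← Finset.sum_sub_distrib]
      exact Finset.sum_congr rfl fun i _ => by ring]
    linarith
  exact sub_eq_zero.1 (congrFun h x)

/-- **The massive torus Green's function exists** (`m > 0`, every period `N ≥ 1`, every `d`): the
massive operator is an injective (`massiveOp_ker_eq_zero`) linear endomorphism of the
finite-dimensional space of functions on the torus, hence surjective; solve `M G(·,y) = δ_y` column by
column. [folklore] -/
theorem massiveGreen_exists :
    ∀ (d N : ℕ) [NeZero N] (m : ℝ), 0 < m → ∃ G : TorusSite d N → TorusSite d N → ℝ, ∀ x y : TorusSite d N, (m ^ 2 + 2 * d) * G x y - ∑ i : Fin d, (G (x + Pi.single i 1) y + G (x - Pi.single i 1) y) = if x = y then 1 else 0 := by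
  intro d N _ m hm
  -- the operator `v ↦ (m² + 2d) v - Σ_i (v (· + eᵢ) + v (· - eᵢ))` as a linear endomorphism
  let L : (TorusSite d N → ℝ) →ₗ[ℝ] (TorusSite d N → ℝ) :=
    { toFun := fun v x => (m ^ 2 + 2 * d) * v x - ∑ i : Fin d, (v (x + Pi.single i 1) + v (x - Pi.single i 1))
      map_add' := by
        intro v w
        funext x
        simp only [Pi.add_apply, Finset.sum_add_distrib]
        ring
      map_smul' := by
        intro c v
        funext x
        simp only [Pi.smul_apply, smul_eq_mul, RingHom.id_apply, Finset.mul_sum, mul_add, mul_sub,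
          Finset.sum_add_distrib]
        ring }
  have hL : ∀ (v : TorusSite d N → ℝ) (x : TorusSite d N),
      L v x = (m ^ 2 + 2 * d) * v x - ∑ i : Fin d, (v (x + Pi.single i 1) + v (x - Pi.single i 1)) :=
    fun v x => rfl
  -- maximum principle: `L` is injective
  have hker : ∀ u : TorusSite d N → ℝ, L u = 0 → u = 0 := fun u hu =>
    massiveOp_ker_eq_zero d N m hm u fun x => by
      have := congrFun hu x
      rwa [hL, Pi.zero_apply] at this
  have hinj : Function.Injective L := by
    intro v w hvw
    have h0 : L (v - w) = 0 := by rw [map_sub, hvw, sub_self]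
    exact sub_eq_zero.1 (hker _ h0)
  have hsurj : Function.Surjective L := LinearMap.surjective_of_injective hinj
  choose u hu using fun y : TorusSite d N => hsurj (fun x => if x = y then (1 : ℝ) else 0)
  refine ⟨fun x y => u y x, fun x y => ?_⟩
  have := congrFun (hu y) x
  rwa [hL] at this

/-- Reordering of a triple finite sum: `Σ_x Σ_a Σ_i f = Σ_i Σ_a Σ_x f`. [folklore] -/
private theorem sum_comm₃ {X A I : Type} [Fintype X] [Fintype A] [Fintype I] (f : X → A → I → ℝ) :
    ∑ x : X, ∑ a : A, ∑ i : I, f x a i = ∑ i : I, ∑ a : A, ∑ x : X, f x a i :=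
  calc ∑ x : X, ∑ a : A, ∑ i : I, f x a i = ∑ x : X, ∑ i : I, ∑ a : A, f x a i :=
        Finset.sum_congr rfl fun _ _ => Finset.sum_comm
    _ = ∑ i : I, ∑ x : X, ∑ a : A, f x a i := Finset.sum_comm
    _ = ∑ i : I, ∑ a : A, ∑ x : X, f x a i := Finset.sum_congr rfl fun _ _ => Finset.sum_comm

/-- **Summation by parts on the torus.** The Gaussian action of the lattice sine-Gordon measure is
the quadratic form of the massive torus Laplacian acting componentwise:
`S_Gauss(φ) = (2g²)⁻¹ Σ_p φ_p ((ε + 2d) φ_p - Σ_i (φ_{(p.1+eᵢ, p.2)} + φ_{(p.1-eᵢ, p.2)}))`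
(expand the squares; `Σ_x φ(x+eᵢ)² = Σ_x φ(x)²` and `Σ_x φ(x) φ(x-eᵢ) = Σ_x φ(x+eᵢ) φ(x)` by
reindexing — valid for all periods, including `N = 1, 2`). [folklore] -/
theorem gaussianAction_eq_quadraticForm :
    ∀ (d N k : ℕ) [NeZero N] (g ε : ℝ) (φ : LatticeSineGordon.Config d N k), LatticeSineGordon.gaussianAction g ε φ = (2 * g ^ 2)⁻¹ * ∑ p : TorusSite d N × Fin k, φ p * ((ε + 2 * d) * φ p - ∑ i : Fin d, (φ (p.1 + Pi.single i 1, p.2) + φ (p.1 - Pi.single i 1, p.2))) := by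
  intro d N k _ g ε φ
  unfold LatticeSineGordon.gaussianAction
  congr 1
  -- both sides as `ε Σ φ² + Σ_i Σ_a Σ_x (…)`
  have hL : ∑ x : TorusSite d N, ∑ i : Fin d, ∑ a : Fin k, (φ (x + Pi.single i 1, a) - φ (x, a)) ^ 2 =
      ∑ i : Fin d, ∑ a : Fin k, ∑ x : TorusSite d N, (φ (x + Pi.single i 1, a) - φ (x, a)) ^ 2 := by
    rw [Finset.sum_comm]
    exact Finset.sum_congr rfl fun i _ => Finset.sum_comm
  have h1 : ∀ p : TorusSite d N × Fin k, φ p * ((ε + 2 * d) * φ p -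
      ∑ i : Fin d, (φ (p.1 + Pi.single i 1, p.2) + φ (p.1 - Pi.single i 1, p.2))) =
      ε * φ p ^ 2 + ∑ i : Fin d, (2 * φ p ^ 2 - φ p * φ (p.1 + Pi.single i 1, p.2) -
        φ p * φ (p.1 - Pi.single i 1, p.2)) := by
    intro p
    have hsplit : ∑ i : Fin d, φ p * (φ (p.1 + Pi.single i 1, p.2) + φ (p.1 - Pi.single i 1, p.2)) =
        ∑ i : Fin d, φ p * φ (p.1 + Pi.single i 1, p.2) + ∑ i : Fin d, φ p * φ (p.1 - Pi.single i 1, p.2) := by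
      rw [← Finset.sum_add_distrib]
      exact Finset.sum_congr rfl fun i _ => mul_add _ _ _
    rw [mul_sub, Finset.mul_sum, hsplit, Finset.sum_sub_distrib, Finset.sum_sub_distrib, Finset.sum_const,
      Finset.card_univ, Fintype.card_fin, nsmul_eq_mul]
    ring
  have hR : ∑ p : TorusSite d N × Fin k, φ p * ((ε + 2 * d) * φ p -
      ∑ i : Fin d, (φ (p.1 + Pi.single i 1, p.2) + φ (p.1 - Pi.single i 1, p.2))) =
      ε * ∑ p : TorusSite d N × Fin k, φ p ^ 2 + ∑ i : Fin d, ∑ a : Fin k, ∑ x : TorusSite d N,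
        (2 * φ (x, a) ^ 2 - φ (x, a) * φ (x + Pi.single i 1, a) - φ (x, a) * φ (x - Pi.single i 1, a)) := by
    rw [Finset.sum_congr rfl fun p _ => h1 p, Finset.sum_add_distrib, ← Finset.mul_sum]
    congr 1
    rw [Fintype.sum_prod_type]
    exact sum_comm₃ _
  rw [hL, hR, add_comm]
  congr 1
  refine Finset.sum_congr rfl fun i _ => Finset.sum_congr rfl fun a _ => ?_
  -- one direction `i`, one component `a`: reindex `x ↦ x + eᵢ`
  have hA : ∑ x : TorusSite d N, φ (x + Pi.single i 1, a) ^ 2 = ∑ x : TorusSite d N, φ (x, a) ^ 2 :=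
    Fintype.sum_equiv (Equiv.addRight (Pi.single i (1 : ZMod N))) _ _ fun x => rfl
  have hB : ∑ x : TorusSite d N, φ (x, a) * φ (x - Pi.single i 1, a) =
      ∑ x : TorusSite d N, φ (x + Pi.single i 1, a) * φ (x, a) := by
    refine (Fintype.sum_equiv (Equiv.addRight (Pi.single i (1 : ZMod N))) _ _ fun x => ?_).symm
    simp only [Equiv.coe_addRight, add_sub_cancel_right]
  have hsq : ∀ x : TorusSite d N, (φ (x + Pi.single i 1, a) - φ (x, a)) ^ 2 =
      φ (x + Pi.single i 1, a) ^ 2 - 2 * (φ (x + Pi.single i 1, a) * φ (x, a)) + φ (x, a) ^ 2 := fun x => by ring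
  have hrhs : ∀ x : TorusSite d N, 2 * φ (x, a) ^ 2 - φ (x, a) * φ (x + Pi.single i 1, a) - φ (x, a) * φ (x - Pi.single i 1, a) =
      2 * φ (x, a) ^ 2 - φ (x + Pi.single i 1, a) * φ (x, a) - φ (x, a) * φ (x - Pi.single i 1, a) := fun x => by ring
  simp only [hsq, hrhs, Finset.sum_add_distrib, Finset.sum_sub_distrib, ← Finset.mul_sum, hA, hB]
  ring

/-- **Separated cubes are far in the first coordinate.** For residues `a, b ∈ ℤ/N` with
`a.val, b.val ≤ R₀` and `2n < N`, the difference `a - (b + n)` is not the class of any integer `z` with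
`|z| < n - R₀`: otherwise `N ∣ z - (a.val - b.val - n) ∈ (0, 2n) ⊂ (0, N)`.  (Sites of the cube
`{x | ∀ i, (x i).val ≤ R₀}` versus sites of its translate by `n e₀`, as in DS′.) [folklore] -/
theorem torus_coord_far :
    ∀ (N R₀ n : ℕ) [NeZero N] (a b : ZMod N), a.val ≤ R₀ → b.val ≤ R₀ → 2 * n < N → ∀ z : ℤ, |z| < (n : ℤ) - R₀ → a - (b + (n : ZMod N)) ≠ (z : ZMod N) := by
  intro N R₀ n _ a b ha hb hn z hz h
  have hcast : (((a.val : ℤ) - b.val - n : ℤ) : ZMod N) = (z : ZMod N) := by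
    push_cast
    rw [ZMod.natCast_zmod_val a, ZMod.natCast_zmod_val b, ← h]
    ring
  rw [ZMod.intCast_eq_intCast_iff_dvd_sub] at hcast
  obtain ⟨hz1, hz2⟩ := abs_lt.1 hz
  have h0 : (0 : ℤ) ≤ a.val := by positivity
  have hbR : (b.val : ℤ) ≤ R₀ := by exact_mod_cast hb
  have h2n : (2 * n : ℤ) < N := by exact_mod_cast hn
  have hs_pos : 0 < z - ((a.val : ℤ) - b.val - n) := by linarith
  have hs_lt : z - ((a.val : ℤ) - b.val - n) < N := by linarith
  have hs0 := Int.eq_zero_of_dvd_of_natAbs_lt_natAbs hcast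
    (Int.natAbs_lt_natAbs_of_nonneg_of_lt hs_pos.le hs_lt)
  linarith

end Summit.QuantumFields.YangMills.Theorems.AnchorGap

end
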